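import Literature.Analysis.FluidPDE.PineauVicolBernoulli

/-!
# Ideator 1 (crux `stmt-NavierStokesRegularity-2955`, FrequencyRigidity) — KERNEL-CHECKED identities
# behind the crux idea `rotation-gauged-head` (planner-cruxidea-stmt-NavierStokesRegularity-2955-1-g2-0,
# 2026-08-16; `lean check` rc 0, no `sorry`, axioms `propext, Classical.choice, Quot.sound`).

Vocabulary: exactly that of `Literature.Analysis.FluidPDE.PineauVicol2026.bernoulli_identity_rdss`
(Pineau–Vicol arXiv:2607.09619, (1.14a)/(7.7): `ν = 1`, `a = ½`, `J = rotGen = e₃ × ·`), i.e. one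
time-slice of the rotated profile system
`U_s + α(JU − DU(Jy)) + ½U + ½DU(y) − ΔU + (U·∇)U + ∇P = 0` (`ProfileEq α U Us P`).

* `torqueLaw` — **the angular-momentum (torque) law**: for `ℓ(y) = ⟪Jy, U(y)⟫`,
  `Δℓ − Dℓ[U + ½y] = ⟪Jy, ∇P⟫ + ⟪Jy, U_s + α(JU − DU(Jy))⟫ + 2(curl U)₃`
  (only smoothness of `U` and the slice system are used: no `div U = 0`, no pressure equation).
* `rotatingBernoulliIdentity` — **the rotation-gauged Bernoulli identity**: for the gauged head
  `Π_α = P + ½|U|² + ½y·U − α⟪Jy, U⟫` and the co-rotating drift operator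
  `L_α f = Δf − Df[U + ½y − αJy]`,
  `L_α Π_α = |curl U|² − 2α (curl U)₃ + ⟪U + ½y − αJy, U_s⟫ = |curl U − αe₃|² − α² + ⟪b_α, U_s⟫`,
  from `torqueLaw` and the tree's `bernoulli_identity_rdss` (which needs `div U = 0` and
  `ΔP = −tr((∇U)²)`). On a rotating wave (`U_s = 0`, RSS) the right side is `|Ω − αe₃|² − α²`:
  the "α-dependent modification of the Bernoulli function" that Pineau–Vicol (p. 4) report as
  unknown, signed up to the explicit constant `α²`; paired with the co-rotating adapted kernel it
  gives the variance identity `∫|Ω − αe₃|² 𝔎 = α²` of the idea card.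
-/

noncomputable section

namespace Summit.NavierStokesRegularity.NavierStokesRegularity.Cruxes.FrequencyRigidity.RotationGaugedHead

open Literature.Analysis.FluidPDE
open scoped RealInnerProductSpace Laplacian ContDiff BigOperators

set_option linter.dupNamespace false

/-- `ℝ³`. -/
abbrev E3 := EuclideanSpace ℝ (Fin 3)

/-- Angular-momentum density about `e₃` (Noether charge density of rotations; KNSS swirl `r u_θ`):
`ℓ(y) = ⟪Jy, U(y)⟫`. -/
def angMom (U : E3 → E3) (y : E3) : ℝ := ⟪rotGen y, U y⟫

/-- One slice of the rotated time-dependent profile system (Pineau–Vicol (1.14a)), `Us = ∂ₛU`. -/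
def ProfileEq (α : ℝ) (U Us : E3 → E3) (P : E3 → ℝ) : Prop :=
  ∀ y, Us y + α • (rotGen (U y) - fderiv ℝ U y (rotGen y)) + (1 / 2 : ℝ) • U y +
    (1 / 2 : ℝ) • fderiv ℝ U y y - (Δ U) y + convect U U y + gradient P y = 0

/-- Pressure Poisson equation in trace form `ΔP = −tr((∇U)²)` (hypothesis of `bernoulli_identity_rdss`). -/
def PoissonEq (U : E3 → E3) (P : E3 → ℝ) : Prop :=
  ∀ y, ∑ l, pderiv l (pderiv l P) y =
    -∑ l, ∑ j, pderiv l (fun z => U z j) y * pderiv j (fun z => U z l) y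

/-- The ROTATION-GAUGED HEAD `Π_α = Π − α ℓ = P + ½|U|² + ½y·U − α⟪Jy, U⟫`. -/
def rotHead (α : ℝ) (U : E3 → E3) (P : E3 → ℝ) (y : E3) : ℝ :=
  headPressure (1 / 2) U P y - α * angMom U y

/-- Drift operator with the CO-ROTATING drift: `L_α f = Δf − Df[U + ½y − αJy] = driftOp 1 ½ U f + α Df[Jy]`. -/
def rotDriftOp (α : ℝ) (U : E3 → E3) (f : E3 → ℝ) (y : E3) : ℝ :=
  driftOp 1 (1 / 2) U f y + α * fderiv ℝ f y (rotGen y)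

/-- `ℓ(z) = z₀ U₁(z) − z₁ U₀(z)`. -/
theorem angMom_eq (U : E3 → E3) : angMom U = fun z => z 0 * U z 1 - z 1 * U z 0 := by
  funext z
  rw [angMom, euclidean_inner_eq_sum_mul, Fin.sum_univ_three]
  simp only [rotGen_apply_zero, rotGen_apply_one, rotGen_apply_two]
  ring

variable {U : E3 → E3}

/-- First partials of `ℓ`. -/
theorem pderiv_angMom (hU : ContDiff ℝ ∞ U) (l : Fin 3) :
    pderiv l (angMom U) = fun z =>
      (if (0 : Fin 3) = l then 1 else 0) * U z 1 + z 0 * pderiv l (fun w => U w 1) z -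
        ((if (1 : Fin 3) = l then 1 else 0) * U z 0 + z 1 * pderiv l (fun w => U w 0) z) := by
  have hUi : ∀ i, Differentiable ℝ (fun z : E3 => U z i) := fun i =>
    (contDiff_comp_euclidean hU i).differentiable (by simp)
  rw [angMom_eq,
    pderiv_sub (f := fun z : E3 => z 0 * U z 1) (g := fun z : E3 => z 1 * U z 0)
      ((differentiable_euclideanCoord 0).mul (hUi 1)) ((differentiable_euclideanCoord 1).mul (hUi 0)),
    pderiv_mul (differentiable_euclideanCoord 0) (hUi 1),
    pderiv_mul (differentiable_euclideanCoord 1) (hUi 0),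
    pderiv_euclideanCoord, pderiv_euclideanCoord]

/-- Second pure partials of `ℓ`. -/
theorem pderiv_pderiv_angMom (hU : ContDiff ℝ ∞ U) (l : Fin 3) :
    pderiv l (pderiv l (angMom U)) = fun z =>
      2 * (if (0 : Fin 3) = l then 1 else 0) * pderiv l (fun w => U w 1) z +
          z 0 * pderiv l (pderiv l (fun w => U w 1)) z -
        (2 * (if (1 : Fin 3) = l then 1 else 0) * pderiv l (fun w => U w 0) z +
          z 1 * pderiv l (pderiv l (fun w => U w 0)) z) := by
  have hUc : ∀ i, ContDiff ℝ ∞ (fun z : E3 => U z i) := fun i => contDiff_comp_euclidean hU i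
  have hUi : ∀ i, Differentiable ℝ (fun z : E3 => U z i) := fun i =>
    (hUc i).differentiable (by simp)
  have hdUi : ∀ i, Differentiable ℝ (pderiv l (fun z : E3 => U z i)) := fun i =>
    (contDiff_pderiv (hUc i) l).differentiable (by simp)
  have hT : ∀ (i k : Fin 3) (c : ℝ),
      Differentiable ℝ (fun z : E3 => c * U z i + z k * pderiv l (fun w => U w i) z) :=
    fun i k c => ((hUi i).const_mul c).add ((differentiable_euclideanCoord k).mul (hdUi i))
  have hT' : ∀ (i k : Fin 3) (c : ℝ),
      pderiv l (fun z : E3 => c * U z i + z k * pderiv l (fun w => U w i) z) = fun z =>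
        c * pderiv l (fun w => U w i) z +
          ((if k = l then 1 else 0) * pderiv l (fun w => U w i) z +
            z k * pderiv l (pderiv l (fun w => U w i)) z) := by
    intro i k c
    rw [pderiv_add (f := fun z : E3 => c * U z i) (g := fun z : E3 => z k * pderiv l (fun w => U w i) z)
        ((hUi i).const_mul c) ((differentiable_euclideanCoord k).mul (hdUi i)),
      pderiv_const_mul (f := fun z : E3 => U z i) (hUi i),
      pderiv_mul (differentiable_euclideanCoord k) (hdUi i), pderiv_euclideanCoord]
  rw [pderiv_angMom hU l,
    pderiv_sub (f := fun z : E3 => (if (0 : Fin 3) = l then 1 else 0) * U z 1 + z 0 * pderiv l (fun w => U w 1) z)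
      (g := fun z : E3 => (if (1 : Fin 3) = l then 1 else 0) * U z 0 + z 1 * pderiv l (fun w => U w 0) z)
      (hT 1 0 _) (hT 0 1 _),
    hT' 1 0, hT' 0 1]
  funext z
  by_cases h0 : (0 : Fin 3) = l
  · subst h0
    simp
    ring
  · by_cases h1 : (1 : Fin 3) = l
    · subst h1
      simp
      ring
    · simp [h0, h1]

/-- **TORQUE LAW** (pointwise angular-momentum law for the rotated slice system; no Poisson
equation needed): `Δℓ − Dℓ[U + ½y] = ⟪Jy, ∇P⟫ + ⟪Jy, Us + α(JU − DU(Jy))⟫ + 2 Ω₃`. -/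
theorem torqueLaw {α : ℝ} {U Us : E3 → E3} {P : E3 → ℝ} (hU : ContDiff ℝ ∞ U)
    (heq : ProfileEq α U Us P) (y : E3) :
    driftOp 1 (1 / 2) U (angMom U) y =
      ⟪rotGen y, gradient P y⟫ + ⟪rotGen y, Us y + α • (rotGen (U y) - fderiv ℝ U y (rotGen y))⟫ +
        2 * (curl U y) 2 := by
  have hUc : ∀ i, ContDiff ℝ ∞ (fun z : E3 => U z i) := fun i => contDiff_comp_euclidean hU i
  have hU2 : ContDiff ℝ 2 U := hU.of_le (WithTop.coe_le_coe.2 le_top)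
  have hdiff : DifferentiableAt ℝ U y := (hU.differentiable (by simp)) y
  have hℓ : ContDiff ℝ ∞ (angMom U) := by
    rw [angMom_eq]
    exact ((contDiff_euclideanCoord 0).mul (hUc 1)).sub ((contDiff_euclideanCoord 1).mul (hUc 0))
  -- the system in coordinates
  have hE : ∀ i, Us y i + α * (rotGen (U y) i - ∑ j, rotGen y j * pderiv j (fun z => U z i) y) +
      1 / 2 * U y i + 1 / 2 * ∑ j, y j * pderiv j (fun z => U z i) y -
      ∑ j, pderiv j (pderiv j fun z => U z i) y + ∑ j, U y j * pderiv j (fun z => U z i) y +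
      pderiv i P y = 0 := by
    intro i
    have hm := congrArg (fun w : E3 => w i) (heq y)
    simp only [PiLp.add_apply, PiLp.sub_apply, PiLp.smul_apply, smul_eq_mul, PiLp.zero_apply] at hm
    rw [laplacian_apply_comp hU2, euclidean_fderiv_apply_comp hdiff (rotGen y),
      euclidean_fderiv_apply_comp hdiff y, fderiv_apply_eq_sum_mul_pderiv,
      fderiv_apply_eq_sum_mul_pderiv, convect_apply_comp hdiff, gradient_apply_comp] at hm
    exact hm
  have hE0 := hE 0
  have hE1 := hE 1
  simp only [Fin.sum_univ_three, rotGen_apply_zero, rotGen_apply_one, rotGen_apply_two] at hE0 hE1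
  -- components of `DU(Jy)` and the third vorticity component
  have hD : ∀ i, fderiv ℝ U y (rotGen y) i = ∑ j, rotGen y j * pderiv j (fun z => U z i) y :=
    fun i => by rw [euclidean_fderiv_apply_comp hdiff, fderiv_apply_eq_sum_mul_pderiv]
  have hD' : ∀ j i : Fin 3, fderiv ℝ U y (EuclideanSpace.single j 1) i = pderiv j (fun z => U z i) y :=
    fun j i => by rw [pderiv_apply, euclidean_fderiv_apply_comp hdiff]
  have hcurl : curl U y 2 = pderiv 0 (fun z => U z 1) y - pderiv 1 (fun z => U z 0) y := by
    simp only [curl, hD']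
    simp
  -- expand the drift operator
  rw [driftOp, one_mul, laplacian_eq_sum_pderiv_pderiv' (hℓ.of_le (WithTop.coe_le_coe.2 le_top)) y,
    fderiv_apply_eq_sum_mul_pderiv, Fin.sum_univ_three, Fin.sum_univ_three,
    congrFun (pderiv_pderiv_angMom hU 0) y, congrFun (pderiv_pderiv_angMom hU 1) y,
    congrFun (pderiv_pderiv_angMom hU 2) y, congrFun (pderiv_angMom hU 0) y,
    congrFun (pderiv_angMom hU 1) y, congrFun (pderiv_angMom hU 2) y]
  -- expand the right-hand side
  rw [euclidean_inner_eq_sum_mul, euclidean_inner_eq_sum_mul, hcurl]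
  simp only [Fin.sum_univ_three, rotGen_apply_zero, rotGen_apply_one, rotGen_apply_two,
    gradient_apply_comp, PiLp.add_apply, PiLp.sub_apply, PiLp.smul_apply, smul_eq_mul, hD]
  have h31 : ((3 : ℕ) = 1) = False := by norm_num
  simp only [Fin.isValue, Fin.one_eq_zero_iff, h31, ite_true, ite_false, Fin.reduceEq]
  linear_combination (y 1) * hE0 - (y 0) * hE1

/-- **ROTATING BERNOULLI IDENTITY** (pointwise): for the rotation-gauged head
`Π_α = Π − α⟪Jy, U⟫` and the co-rotating drift operator `L_α f = Δf − Df[U + ½y − αJy]`,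
`L_α Π_α = |Ω|² − 2αΩ₃ + ⟪U + ½y − αJy, U_s⟫`. -/
theorem rotatingBernoulliIdentity {α : ℝ} {U Us : E3 → E3} {P : E3 → ℝ} (hU : ContDiff ℝ ∞ U)
    (hP : ContDiff ℝ ∞ P) (heq : ProfileEq α U Us P) (hdiv : VectorCalculus.IsDivFree U)
    (hΔP : PoissonEq U P) (y : E3) :
    rotDriftOp α U (rotHead α U P) y =
      ‖curl U y‖ ^ 2 - 2 * α * (curl U y) 2 + ⟪U y + (1 / 2 : ℝ) • y - α • rotGen y, Us y⟫ := by
  have hUc : ∀ i, ContDiff ℝ ∞ (fun z : E3 => U z i) := fun i => contDiff_comp_euclidean hU i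
  have hdiff : DifferentiableAt ℝ U y := (hU.differentiable (by simp)) y
  have hHeadS : ContDiff ℝ ∞ (headPressure (1 / 2) U P) := PineauVicol2026.contDiff_headPressure hU hP _
  have hℓs : ContDiff ℝ ∞ (angMom U) := by
    rw [angMom_eq]
    exact ((contDiff_euclideanCoord 0).mul (hUc 1)).sub ((contDiff_euclideanCoord 1).mul (hUc 0))
  have hHeadD : Differentiable ℝ (headPressure (1 / 2) U P) := hHeadS.differentiable (by simp)
  have hℓd : Differentiable ℝ (angMom U) := hℓs.differentiable (by simp)
  have hHs : ContDiff ℝ ∞ (rotHead α U P) := hHeadS.sub (contDiff_const.mul hℓs)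
  -- first and second partials of the gauged head in terms of those of `Π` and `ℓ`
  have hF1 : ∀ j, pderiv j (rotHead α U P) = fun z =>
      pderiv j (headPressure (1 / 2) U P) z - α * pderiv j (angMom U) z := by
    intro j
    rw [show rotHead α U P = fun z => headPressure (1 / 2) U P z - α * angMom U z from rfl,
      pderiv_sub hHeadD (hℓd.const_mul α), pderiv_const_mul hℓd]
  have hF2 : ∀ j, pderiv j (pderiv j (rotHead α U P)) = fun z =>
      pderiv j (pderiv j (headPressure (1 / 2) U P)) z - α * pderiv j (pderiv j (angMom U)) z := by
    intro j
    have h1 : Differentiable ℝ (pderiv j (headPressure (1 / 2) U P)) :=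
      (contDiff_pderiv hHeadS j).differentiable (by simp)
    have h2 : Differentiable ℝ (pderiv j (angMom U)) := (contDiff_pderiv hℓs j).differentiable (by simp)
    rw [hF1 j, pderiv_sub h1 (h2.const_mul α), pderiv_const_mul h2]
  -- the two structural identities
  have hB := PineauVicol2026.bernoulli_identity_rdss hU hP heq hdiv hΔP y
  have hT := torqueLaw hU heq y
  rw [driftOp, one_mul, laplacian_eq_sum_pderiv_pderiv' (hHeadS.of_le (WithTop.coe_le_coe.2 le_top)) y,
    fderiv_apply_eq_sum_mul_pderiv] at hB
  rw [driftOp, one_mul, laplacian_eq_sum_pderiv_pderiv' (hℓs.of_le (WithTop.coe_le_coe.2 le_top)) y,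
    fderiv_apply_eq_sum_mul_pderiv] at hT
  -- first partials of `Π` and `ℓ`
  have hdHead0 := congrFun (pderiv_headPressure hU hP (1 / 2) 0) y
  have hdHead1 := congrFun (pderiv_headPressure hU hP (1 / 2) 1) y
  have hdℓ0 := congrFun (pderiv_angMom hU 0) y
  have hdℓ1 := congrFun (pderiv_angMom hU 1) y
  -- components of `DU(Jy)`
  have hD : ∀ i, fderiv ℝ U y (rotGen y) i = ∑ j, rotGen y j * pderiv j (fun z => U z i) y :=
    fun i => by rw [euclidean_fderiv_apply_comp hdiff, fderiv_apply_eq_sum_mul_pderiv]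
  -- expand the goal
  rw [rotDriftOp, driftOp, one_mul,
    laplacian_eq_sum_pderiv_pderiv' (hHs.of_le (WithTop.coe_le_coe.2 le_top)) y,
    fderiv_apply_eq_sum_mul_pderiv, fderiv_apply_eq_sum_mul_pderiv]
  simp only [hF2]
  simp only [hF1]
  rw [euclidean_inner_eq_sum_mul]
  rw [euclidean_inner_eq_sum_mul, euclidean_inner_eq_sum_mul, euclidean_inner_eq_sum_mul] at hB
  rw [euclidean_inner_eq_sum_mul, euclidean_inner_eq_sum_mul] at hT
  simp only [Fin.sum_univ_three, rotGen_apply_zero, rotGen_apply_one, rotGen_apply_two,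
    gradient_apply_comp, PiLp.add_apply, PiLp.sub_apply, PiLp.smul_apply, smul_eq_mul, hD] at hB hT hdHead0 hdHead1 hdℓ0 hdℓ1 ⊢
  have h31 : ((3 : ℕ) = 1) = False := by norm_num
  simp only [Fin.isValue, Fin.one_eq_zero_iff, h31, ite_true, ite_false, Fin.reduceEq] at hdℓ0 hdℓ1 ⊢
  linear_combination (-1 : ℝ) * hB - α * hT + (α * (-(y 1))) * hdHead0 + (α * y 0) * hdHead1 -
    (α ^ 2 * (-(y 1))) * hdℓ0 - (α ^ 2 * y 0) * hdℓ1

/-- The rotating Bernoulli identity in completed-square form on a ROTATING WAVE (`U_s = 0`):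
`L_α Π_α = |Ω|² − 2αΩ₃ = |Ω − αe₃|² − α²` written out, i.e. the gauged head is a subsolution of
`−L_α` up to the explicit constant `α²`. -/
theorem rotatingBernoulliIdentity_rss {α : ℝ} {U : E3 → E3} {P : E3 → ℝ} (hU : ContDiff ℝ ∞ U)
    (hP : ContDiff ℝ ∞ P) (heq : ProfileEq α U (fun _ => 0) P) (hdiv : VectorCalculus.IsDivFree U)
    (hΔP : PoissonEq U P) (y : E3) :
    rotDriftOp α U (rotHead α U P) y = ‖curl U y‖ ^ 2 - 2 * α * (curl U y) 2 := by
  rw [rotatingBernoulliIdentity hU hP heq hdiv hΔP y, inner_zero_right, add_zero]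

/-- Pointwise lower bound on a rotating wave: `L_α Π_α ≥ −α²` is NOT what holds; what holds is
`L_α Π_α = |Ω|² − 2αΩ₃ ≥ −α²` in the form `|Ω|² − 2αΩ₃ + α² = ‖Ω‖² − 2αΩ₃ + α² ≥ 0`
(complete the square in the third component and drop the other two squares). -/
theorem rotDriftOp_rotHead_add_sq_nonneg {α : ℝ} {U : E3 → E3} {P : E3 → ℝ} (hU : ContDiff ℝ ∞ U)
    (hP : ContDiff ℝ ∞ P) (heq : ProfileEq α U (fun _ => 0) P) (hdiv : VectorCalculus.IsDivFree U)
    (hΔP : PoissonEq U P) (y : E3) :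
    0 ≤ rotDriftOp α U (rotHead α U P) y + α ^ 2 := by
  rw [rotatingBernoulliIdentity_rss hU hP heq hdiv hΔP y, EuclideanSpace.real_norm_sq_eq,
    Fin.sum_univ_three]
  nlinarith [sq_nonneg ((curl U y) 0), sq_nonneg ((curl U y) 1), sq_nonneg ((curl U y) 2 - α),
    sq_abs ((curl U y) 0), sq_abs ((curl U y) 1), sq_abs ((curl U y) 2)]

end Summit.NavierStokesRegularity.NavierStokesRegularity.Cruxes.FrequencyRigidity.RotationGaugedHead

end
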